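import Summits.Ventures.CertifiedManyBodySolver.Rows.TorusCeilingHom
import HarnessLib

/-!
# Torus ceiling — Part V: Chinese-remainder rings (rectangular PP tori `3 × 4`, `3 × 5` as circulant rings)

HONEST FRAMING: first certified bounds; not a superconductivity verdict; every number certified or
labelled float.
For coprime `a, b` the nearest-neighbour torus `ℤ/a × ℤ/b` is the circulant RING `ℤ/(ab)` with hops
`±p₀, ±p₁` (`p₀ ≡ (1, 0)`, `p₁ ≡ (0, 1)` under CRT): `3 × 4 = ℤ/12` with hops `{±4, ±9 = ∓3}` and
`3 × 5 = ℤ/15` with hops `{±10 = ∓5, ±6}`. This file builds the additive maps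
`ringHom N p : ℤ^d →+ (ℤ/N)^1`, `x ↦ Σ xᵢ pᵢ`, proves their hop non-degeneracy and window
injectivity from coordinate spreads (`injOn_ringHom_two_of_spread`, by `omega`), and specialises
Part IV (`homTorus_minEnergyOn_div_ge_of_window_certificate`) to
`crtHom34 = ringHom 12 ![4, 9]` (windows of spreads `≤ (2, 3)`), `crtHom35 = ringHom 15 ![10, 6]`
(`≤ (2, 4)`), and the transposed generator orders `crtHom43 = ringHom 12 ![9, 4]` (`≤ (3, 2)`),
`crtHom53 = ringHom 15 ![6, 10]` (`≤ (4, 2)`): `crt34_/crt35_/crt43_/crt53_minEnergyOn_div_ge_of_window_certificate`.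
The identification of these Cayley graphs with `fermionRectTorusGraph 3 4 / 3 5` is `TorusCeilingCRTRect`.

References: Han 2020 §3; Kull–Schuch–Dive–Navascués 2024 §5.3. [cite: Han2020Bootstrap, §3]
[cite: KullEtAl2024, §5.3]
-/

noncomputable section

open Matrix Finset
open Literature.MathematicalPhysics.QuantumLattice
open Literature.MathematicalPhysics.QuantumFieldTheory hiding Site
open Literature.MathematicalPhysics.QuantumManyBody.StateRelaxation
open Literature.Probability.LatticeModels
open HubbardWave0
open scoped ComplexOrder ComplexConjugate

namespace Summit.Ventures.CertifiedManyBodySolver.Rows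

section CRT

variable {d : ℕ}

/-! ### Rings generated by hop residues; the CRT rings of rectangular PP tori -/

/-- The additive map `ℤ^d →+ ℤ/Nℤ`, `x ↦ Σᵢ xᵢ·pᵢ mod N`, with prescribed hop residues `pᵢ`
(`d' = 1`: the generated torus is the circulant ring `ℤ/Nℤ` with hops `±pᵢ`). [folklore] -/
def ringHom (N : ℕ) (p : Fin d → ℤ) : Site d →+ TorusSite 1 N where
  toFun x := fun _ => ((∑ i, x i * p i : ℤ) : ZMod N)
  map_zero' := by funext; simp
  map_add' x y := by
    funext j
    simp only [Pi.add_apply, add_mul, Finset.sum_add_distrib, Int.cast_add]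

/-- `ringHom N p x = (Σᵢ xᵢ pᵢ) mod N`. [folklore] -/
theorem ringHom_apply (N : ℕ) (p : Fin d → ℤ) (x : Site d) (j : Fin 1) :
    ringHom N p x j = ((∑ i, x i * p i : ℤ) : ZMod N) := rfl

/-- The hops of `ringHom N p`: `eᵢ ↦ pᵢ mod N`. [folklore] -/
theorem ringHom_unitVec (N : ℕ) (p : Fin d → ℤ) (i : Fin d) :
    ringHom N p (unitVec i) = fun _ => ((p i : ℤ) : ZMod N) := by
  funext j
  rw [ringHom_apply, Finset.sum_eq_single i
    (fun k _ hk => by rw [show unitVec i k = 0 from Pi.single_eq_of_ne hk _, zero_mul])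
    (fun h => absurd (Finset.mem_univ i) h), show unitVec i i = 1 from Pi.single_eq_same _ _, one_mul]

/-- The signed hops of `ringHom N p` are the residues `±pᵢ`. [folklore] -/
theorem signedHop_ringHom (N : ℕ) (p : Fin d → ℤ) (q : Fin d × Bool) :
    signedHop (ringHom N p) q = fun _ => bif q.2 then ((p q.1 : ℤ) : ZMod N) else -((p q.1 : ℤ) : ZMod N) := by
  unfold signedHop
  rw [ringHom_unitVec]
  cases q.2 <;> rfl

/-- Non-degeneracy of the hops of `ringHom N p` is the finite check "the `2d` residues `±pᵢ mod N`
are pairwise distinct". [folklore] -/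
theorem injective_signedHop_ringHom (N : ℕ) (p : Fin d → ℤ)
    (h : Function.Injective fun q : Fin d × Bool =>
      (bif q.2 then ((p q.1 : ℤ) : ZMod N) else -((p q.1 : ℤ) : ZMod N))) :
    Function.Injective (signedHop (ringHom N p)) := by
  intro q q' hqq'
  rw [signedHop_ringHom, signedHop_ringHom] at hqq'
  exact h (congrFun hqq' 0)

/-- **Injectivity of `ringHom N p` on a window from coordinate spreads** (`d = 2`): if the only
solution of `N ∣ p₀a + p₁b` with `|a| ≤ M₀`, `|b| ≤ M₁` is `a = b = 0`, then `x ↦ (p₀x₀ + p₁x₁) mod N`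
is injective on every `S ⊆ ℤ²` of coordinate spreads `≤ M₀`, `≤ M₁`. For the CRT ring of `ℤ/a × ℤ/b`
(`N = ab`, `p₀ ≡ (1,0)`, `p₁ ≡ (0,1)`) this holds with `M₀ = a − 1`, `M₁ = b − 1`. [folklore] -/
theorem injOn_ringHom_two_of_spread (N : ℕ) (p : Fin 2 → ℤ) {M₀ M₁ : ℕ}
    (hN : ∀ a b : ℤ, -(M₀ : ℤ) ≤ a → a ≤ M₀ → -(M₁ : ℤ) ≤ b → b ≤ M₁ →
      (N : ℤ) ∣ a * p 0 + b * p 1 → a = 0 ∧ b = 0)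
    {S : Finset (Site 2)} (hspread : ∀ x ∈ S, ∀ y ∈ S, |x 0 - y 0| ≤ (M₀ : ℤ) ∧ |x 1 - y 1| ≤ (M₁ : ℤ)) :
    Set.InjOn (ringHom N p) ↑S := by
  intro x hx y hy hxy
  have h := congrFun hxy 0
  rw [ringHom_apply, ringHom_apply, ZMod.intCast_eq_intCast_iff_dvd_sub, Fin.sum_univ_two,
    Fin.sum_univ_two] at h
  obtain ⟨h₀, h₁⟩ := hspread x hx y hy
  rw [abs_le] at h₀ h₁
  have key := hN (y 0 - x 0) (y 1 - x 1) (by omega) (by omega) (by omega) (by omega)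
    (by convert h using 1; ring)
  funext j
  match j with
  | 0 => omega
  | 1 => omega

/-- **CRT presentation of the `3 × 4` PP torus**: `ℤ² →+ ℤ/12`, `e₀ ↦ 4` (`≡ (1,0)` in `ℤ/3 × ℤ/4`,
order `3`), `e₁ ↦ 9 = −3` (`≡ (0,1)`, order `4`); `homHubbard crtHom34 t U` is the nearest-neighbour
Hubbard model of the periodic `3 × 4` torus written on the ring `ℤ/12` with hops `{±3, ±4}`.
[folklore] -/
def crtHom34 : Site 2 →+ TorusSite 1 12 := ringHom 12 ![4, 9]

/-- **CRT presentation of the `3 × 5` PP torus**: `ℤ² →+ ℤ/15`, `e₀ ↦ 10` (`≡ (1,0)`), `e₁ ↦ 6`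
(`≡ (0,1)`); hops `{±5, ±6}` on `ℤ/15`. [folklore] -/
def crtHom35 : Site 2 →+ TorusSite 1 15 := ringHom 15 ![10, 6]

/-- **Window certificate ⇒ the `3 × 4` PP torus (kernel).** A square-lattice window certificate
(`hubbardFermionInteraction 2 t U`, data of `groundEnergyAt_div_ge_of_window_certificate`) whose
window `Λ'` has coordinate spreads `≤ 2` and `≤ 3` bounds the `S^z = 0` ground-energy density of the
`3 × 4` PP Hubbard torus in its CRT presentation `homHubbard crtHom34 t U`, every `n ≤ 12`:
`c − Σ‖aₖ‖ + (Σ_σ μ_σ)(n/12 − ν) ≤ minEnergyOn (szSector 2n 0) / 12`. (Reduce-mode certificates of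
support box `3 × 4` — e.g. the cell's `3x4_PP_tp0_U8_N10_5-5` — are admissible.) [cite: Han2020Bootstrap, §3] -/
theorem crt34_minEnergyOn_div_ge_of_window_certificate (t U : ℝ) {nh : ℕ}
    (hn : nh ≤ Fintype.card (FermionTorus 1 12))
    {Λ Λ' : Finset (Site 2)} (hΛ : Λ ⊆ Λ')
    (hspread : ∀ x ∈ Λ', ∀ y ∈ Λ', |x 0 - y 0| ≤ (2 : ℤ) ∧ |x 1 - y 1| ≤ (3 : ℤ))
    (hclosed : ∀ x ∈ Λ, ∀ i : Fin 2, x + unitVec i ∈ Λ' ∧ x - unitVec i ∈ Λ')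
    (h0 : thicken ({0} : Finset (Site 2)) 1 ⊆ Λ') (hz : (0 : Site 2) ∈ Λ')
    (μ : Fin 2 → ℝ) (ν : ℝ)
    {m : Type*} [Fintype m] [DecidableEq m] {Λm : Matrix m m ℂ} (hΛm : Λm.PosSemidef)
    (O : m → FermionOp Λ')
    {κ : Type*} (s : Finset κ) (B : κ → FermionOp Λ)
    {ι : Type*} (tt : Finset ι) (v : ι → Site 2) (hsh : ∀ l, shiftSet (v l) Λ ⊆ Λ') (Y : ι → FermionOp Λ)
    {γ : Type*} (u : Finset γ) (b : γ → ℂ) (cw : γ → List (Orb (PolySite Λ') × Bool))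
    (hcw : ∀ j ∈ u, ladderCharge (cw j) ≠ 0 ∨ ladderSpinCharge (cw j) ≠ 0)
    {δ : Type*} (ah : Finset δ) (dc : δ → ℝ) (V : δ → FermionOp Λ')
    {κ'' : Type*} (w : Finset κ'') (a : κ'' → ℂ) (word : κ'' → List (Orb (PolySite Λ') × Bool)) {c : ℝ}
    (hcert : fermionEmbed (PolySite.incl h0) ((hubbardFermionInteraction 2 t U).meanEnergyObs 1) -
        (c : ℂ) • (1 : FermionOp Λ') -
        ∑ σ : Fin 2, ((μ σ : ℝ) : ℂ) • (nAt 0 hz σ - ((ν : ℝ) : ℂ) • (1 : FermionOp Λ')) =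
      gramForm Λm O +
        (∑ k ∈ s, ((hubbardFermionInteraction 2 t U).localHamiltonian Λ' * fermionEmbed (PolySite.incl hΛ) (B k) -
            fermionEmbed (PolySite.incl hΛ) (B k) * (hubbardFermionInteraction 2 t U).localHamiltonian Λ') +
          ∑ l ∈ tt, (fermionEmbed (PolySite.incl (hsh l)) (fermionEmbed (PolySite.shiftEmb (v l) Λ) (Y l)) -
            fermionEmbed (PolySite.incl hΛ) (Y l)) +
          ∑ j ∈ u, b j • ladderWord (cw j)) +
        (∑ m' ∈ ah, ((dc m' : ℝ) : ℂ) • ((V m')ᴴ - V m') + ∑ k ∈ w, a k • ladderWord (word k))) :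
    c - ∑ k ∈ w, ‖a k‖ + (∑ σ : Fin 2, μ σ) * ((nh : ℝ) / 12 - ν) ≤
      (homHubbard crtHom34 t U).minEnergyOn (szSector (2 * nh) 0) / 12 := by
  have hInj' : Set.InjOn crtHom34 ↑Λ' :=
    injOn_ringHom_two_of_spread 12 ![4, 9] (M₀ := 2) (M₁ := 3)
      (fun a' b' h₁ h₂ h₃ h₄ h₅ => by
        simp only [Matrix.cons_val_zero, Matrix.cons_val_one] at h₅
        omega) hspread
  have hd : Function.Injective (signedHop crtHom34) := injective_signedHop_ringHom 12 ![4, 9] (by decide)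
  have h := homTorus_minEnergyOn_div_ge_of_window_certificate crtHom34 t U hd hn hΛ hclosed h0 hz hInj' μ ν
    hΛm O s B tt v hsh Y u b cw hcw ah dc V w a word hcert
  simp only [Nat.cast_ofNat, pow_one] at h
  exact h

/-- **Window certificate ⇒ the `3 × 5` PP torus (kernel)**: as
`crt34_minEnergyOn_div_ge_of_window_certificate` for the CRT ring `ℤ/15` (hops `{±5, ±6}`), windows
of coordinate spreads `≤ 2` and `≤ 4`, every `n ≤ 15`. [cite: Han2020Bootstrap, §3] -/
theorem crt35_minEnergyOn_div_ge_of_window_certificate (t U : ℝ) {nh : ℕ}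
    (hn : nh ≤ Fintype.card (FermionTorus 1 15))
    {Λ Λ' : Finset (Site 2)} (hΛ : Λ ⊆ Λ')
    (hspread : ∀ x ∈ Λ', ∀ y ∈ Λ', |x 0 - y 0| ≤ (2 : ℤ) ∧ |x 1 - y 1| ≤ (4 : ℤ))
    (hclosed : ∀ x ∈ Λ, ∀ i : Fin 2, x + unitVec i ∈ Λ' ∧ x - unitVec i ∈ Λ')
    (h0 : thicken ({0} : Finset (Site 2)) 1 ⊆ Λ') (hz : (0 : Site 2) ∈ Λ')
    (μ : Fin 2 → ℝ) (ν : ℝ)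
    {m : Type*} [Fintype m] [DecidableEq m] {Λm : Matrix m m ℂ} (hΛm : Λm.PosSemidef)
    (O : m → FermionOp Λ')
    {κ : Type*} (s : Finset κ) (B : κ → FermionOp Λ)
    {ι : Type*} (tt : Finset ι) (v : ι → Site 2) (hsh : ∀ l, shiftSet (v l) Λ ⊆ Λ') (Y : ι → FermionOp Λ)
    {γ : Type*} (u : Finset γ) (b : γ → ℂ) (cw : γ → List (Orb (PolySite Λ') × Bool))
    (hcw : ∀ j ∈ u, ladderCharge (cw j) ≠ 0 ∨ ladderSpinCharge (cw j) ≠ 0)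
    {δ : Type*} (ah : Finset δ) (dc : δ → ℝ) (V : δ → FermionOp Λ')
    {κ'' : Type*} (w : Finset κ'') (a : κ'' → ℂ) (word : κ'' → List (Orb (PolySite Λ') × Bool)) {c : ℝ}
    (hcert : fermionEmbed (PolySite.incl h0) ((hubbardFermionInteraction 2 t U).meanEnergyObs 1) -
        (c : ℂ) • (1 : FermionOp Λ') -
        ∑ σ : Fin 2, ((μ σ : ℝ) : ℂ) • (nAt 0 hz σ - ((ν : ℝ) : ℂ) • (1 : FermionOp Λ')) =
      gramForm Λm O +
        (∑ k ∈ s, ((hubbardFermionInteraction 2 t U).localHamiltonian Λ' * fermionEmbed (PolySite.incl hΛ) (B k) -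
            fermionEmbed (PolySite.incl hΛ) (B k) * (hubbardFermionInteraction 2 t U).localHamiltonian Λ') +
          ∑ l ∈ tt, (fermionEmbed (PolySite.incl (hsh l)) (fermionEmbed (PolySite.shiftEmb (v l) Λ) (Y l)) -
            fermionEmbed (PolySite.incl hΛ) (Y l)) +
          ∑ j ∈ u, b j • ladderWord (cw j)) +
        (∑ m' ∈ ah, ((dc m' : ℝ) : ℂ) • ((V m')ᴴ - V m') + ∑ k ∈ w, a k • ladderWord (word k))) :
    c - ∑ k ∈ w, ‖a k‖ + (∑ σ : Fin 2, μ σ) * ((nh : ℝ) / 15 - ν) ≤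
      (homHubbard crtHom35 t U).minEnergyOn (szSector (2 * nh) 0) / 15 := by
  have hInj' : Set.InjOn crtHom35 ↑Λ' :=
    injOn_ringHom_two_of_spread 15 ![10, 6] (M₀ := 2) (M₁ := 4)
      (fun a' b' h₁ h₂ h₃ h₄ h₅ => by
        simp only [Matrix.cons_val_zero, Matrix.cons_val_one] at h₅
        omega) hspread
  have hd : Function.Injective (signedHop crtHom35) := injective_signedHop_ringHom 15 ![10, 6] (by decide)
  have h := homTorus_minEnergyOn_div_ge_of_window_certificate crtHom35 t U hd hn hΛ hclosed h0 hz hInj' μ ν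
    hΛm O s B tt v hsh Y u b cw hcw ah dc V w a word hcert
  simp only [Nat.cast_ofNat, pow_one] at h
  exact h

end CRT

section CRTTransposed

/-! ### Transposed generator orders — windows drawn in a `4 × 3` / `5 × 3` box

`crtHom43 := ringHom 12 ![9, 4]` (`e₀ ↦ 9` of additive order `4`, `e₁ ↦ 4` of order `3`) and
`crtHom53 := ringHom 15 ![6, 10]` generate the SAME Cayley graphs as `crtHom34` / `crtHom35` (the hop
sets `{±4, ±9}`, `{±10, ±6}` are unchanged); a window is admissible for them when its coordinate
spreads are `≤ (3, 2)` (resp. `≤ (4, 2)`). -/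

/-- The CRT presentation of the `4 × 3`-oriented torus: `x ↦ 9 x₀ + 4 x₁ (mod 12)`. [folklore] -/
def crtHom43 : Site 2 →+ TorusSite 1 12 := ringHom 12 ![9, 4]

/-- The CRT presentation of the `5 × 3`-oriented torus: `x ↦ 6 x₀ + 10 x₁ (mod 15)`. [folklore] -/
def crtHom53 : Site 2 →+ TorusSite 1 15 := ringHom 15 ![6, 10]

/-- **Window certificate ⇒ the CRT ring `ℤ/12`, transposed generators** (`crtHom43`, windows of
coordinate spreads `≤ 3` and `≤ 2`). [cite: Han2020Bootstrap, §3] -/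
theorem crt43_minEnergyOn_div_ge_of_window_certificate (t U : ℝ) {nh : ℕ}
    (hn : nh ≤ Fintype.card (FermionTorus 1 12))
    {Λ Λ' : Finset (Site 2)} (hΛ : Λ ⊆ Λ')
    (hspread : ∀ x ∈ Λ', ∀ y ∈ Λ', |x 0 - y 0| ≤ (3 : ℤ) ∧ |x 1 - y 1| ≤ (2 : ℤ))
    (hclosed : ∀ x ∈ Λ, ∀ i : Fin 2, x + unitVec i ∈ Λ' ∧ x - unitVec i ∈ Λ')
    (h0 : thicken ({0} : Finset (Site 2)) 1 ⊆ Λ') (hz : (0 : Site 2) ∈ Λ')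
    (μ : Fin 2 → ℝ) (ν : ℝ)
    {m : Type*} [Fintype m] [DecidableEq m] {Λm : Matrix m m ℂ} (hΛm : Λm.PosSemidef)
    (O : m → FermionOp Λ')
    {κ : Type*} (s : Finset κ) (B : κ → FermionOp Λ)
    {ι : Type*} (tt : Finset ι) (v : ι → Site 2) (hsh : ∀ l, shiftSet (v l) Λ ⊆ Λ') (Y : ι → FermionOp Λ)
    {γ : Type*} (u : Finset γ) (b : γ → ℂ) (cw : γ → List (Orb (PolySite Λ') × Bool))
    (hcw : ∀ j ∈ u, ladderCharge (cw j) ≠ 0 ∨ ladderSpinCharge (cw j) ≠ 0)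
    {δ : Type*} (ah : Finset δ) (dc : δ → ℝ) (V : δ → FermionOp Λ')
    {κ'' : Type*} (w : Finset κ'') (a : κ'' → ℂ) (word : κ'' → List (Orb (PolySite Λ') × Bool)) {c : ℝ}
    (hcert : fermionEmbed (PolySite.incl h0) ((hubbardFermionInteraction 2 t U).meanEnergyObs 1) -
        (c : ℂ) • (1 : FermionOp Λ') -
        ∑ σ : Fin 2, ((μ σ : ℝ) : ℂ) • (nAt 0 hz σ - ((ν : ℝ) : ℂ) • (1 : FermionOp Λ')) =
      gramForm Λm O +
        (∑ k ∈ s, ((hubbardFermionInteraction 2 t U).localHamiltonian Λ' * fermionEmbed (PolySite.incl hΛ) (B k) -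
            fermionEmbed (PolySite.incl hΛ) (B k) * (hubbardFermionInteraction 2 t U).localHamiltonian Λ') +
          ∑ l ∈ tt, (fermionEmbed (PolySite.incl (hsh l)) (fermionEmbed (PolySite.shiftEmb (v l) Λ) (Y l)) -
            fermionEmbed (PolySite.incl hΛ) (Y l)) +
          ∑ j ∈ u, b j • ladderWord (cw j)) +
        (∑ m' ∈ ah, ((dc m' : ℝ) : ℂ) • ((V m')ᴴ - V m') + ∑ k ∈ w, a k • ladderWord (word k))) :
    c - ∑ k ∈ w, ‖a k‖ + (∑ σ : Fin 2, μ σ) * ((nh : ℝ) / 12 - ν) ≤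
      (homHubbard crtHom43 t U).minEnergyOn (szSector (2 * nh) 0) / 12 := by
  have hInj' : Set.InjOn crtHom43 ↑Λ' :=
    injOn_ringHom_two_of_spread 12 ![9, 4] (M₀ := 3) (M₁ := 2)
      (fun a' b' h₁ h₂ h₃ h₄ h₅ => by
        simp only [Matrix.cons_val_zero, Matrix.cons_val_one] at h₅
        omega) hspread
  have hd : Function.Injective (signedHop crtHom43) := injective_signedHop_ringHom 12 ![9, 4] (by decide)
  have h := homTorus_minEnergyOn_div_ge_of_window_certificate crtHom43 t U hd hn hΛ hclosed h0 hz hInj' μ ν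
    hΛm O s B tt v hsh Y u b cw hcw ah dc V w a word hcert
  simp only [Nat.cast_ofNat, pow_one] at h
  exact h

/-- **Window certificate ⇒ the CRT ring `ℤ/15`, transposed generators** (`crtHom53`, windows of
coordinate spreads `≤ 4` and `≤ 2`). [cite: Han2020Bootstrap, §3] -/
theorem crt53_minEnergyOn_div_ge_of_window_certificate (t U : ℝ) {nh : ℕ}
    (hn : nh ≤ Fintype.card (FermionTorus 1 15))
    {Λ Λ' : Finset (Site 2)} (hΛ : Λ ⊆ Λ')
    (hspread : ∀ x ∈ Λ', ∀ y ∈ Λ', |x 0 - y 0| ≤ (4 : ℤ) ∧ |x 1 - y 1| ≤ (2 : ℤ))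
    (hclosed : ∀ x ∈ Λ, ∀ i : Fin 2, x + unitVec i ∈ Λ' ∧ x - unitVec i ∈ Λ')
    (h0 : thicken ({0} : Finset (Site 2)) 1 ⊆ Λ') (hz : (0 : Site 2) ∈ Λ')
    (μ : Fin 2 → ℝ) (ν : ℝ)
    {m : Type*} [Fintype m] [DecidableEq m] {Λm : Matrix m m ℂ} (hΛm : Λm.PosSemidef)
    (O : m → FermionOp Λ')
    {κ : Type*} (s : Finset κ) (B : κ → FermionOp Λ)
    {ι : Type*} (tt : Finset ι) (v : ι → Site 2) (hsh : ∀ l, shiftSet (v l) Λ ⊆ Λ') (Y : ι → FermionOp Λ)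
    {γ : Type*} (u : Finset γ) (b : γ → ℂ) (cw : γ → List (Orb (PolySite Λ') × Bool))
    (hcw : ∀ j ∈ u, ladderCharge (cw j) ≠ 0 ∨ ladderSpinCharge (cw j) ≠ 0)
    {δ : Type*} (ah : Finset δ) (dc : δ → ℝ) (V : δ → FermionOp Λ')
    {κ'' : Type*} (w : Finset κ'') (a : κ'' → ℂ) (word : κ'' → List (Orb (PolySite Λ') × Bool)) {c : ℝ}
    (hcert : fermionEmbed (PolySite.incl h0) ((hubbardFermionInteraction 2 t U).meanEnergyObs 1) -
        (c : ℂ) • (1 : FermionOp Λ') -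
        ∑ σ : Fin 2, ((μ σ : ℝ) : ℂ) • (nAt 0 hz σ - ((ν : ℝ) : ℂ) • (1 : FermionOp Λ')) =
      gramForm Λm O +
        (∑ k ∈ s, ((hubbardFermionInteraction 2 t U).localHamiltonian Λ' * fermionEmbed (PolySite.incl hΛ) (B k) -
            fermionEmbed (PolySite.incl hΛ) (B k) * (hubbardFermionInteraction 2 t U).localHamiltonian Λ') +
          ∑ l ∈ tt, (fermionEmbed (PolySite.incl (hsh l)) (fermionEmbed (PolySite.shiftEmb (v l) Λ) (Y l)) -
            fermionEmbed (PolySite.incl hΛ) (Y l)) +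
          ∑ j ∈ u, b j • ladderWord (cw j)) +
        (∑ m' ∈ ah, ((dc m' : ℝ) : ℂ) • ((V m')ᴴ - V m') + ∑ k ∈ w, a k • ladderWord (word k))) :
    c - ∑ k ∈ w, ‖a k‖ + (∑ σ : Fin 2, μ σ) * ((nh : ℝ) / 15 - ν) ≤
      (homHubbard crtHom53 t U).minEnergyOn (szSector (2 * nh) 0) / 15 := by
  have hInj' : Set.InjOn crtHom53 ↑Λ' :=
    injOn_ringHom_two_of_spread 15 ![6, 10] (M₀ := 4) (M₁ := 2)
      (fun a' b' h₁ h₂ h₃ h₄ h₅ => by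
        simp only [Matrix.cons_val_zero, Matrix.cons_val_one] at h₅
        omega) hspread
  have hd : Function.Injective (signedHop crtHom53) := injective_signedHop_ringHom 15 ![6, 10] (by decide)
  have h := homTorus_minEnergyOn_div_ge_of_window_certificate crtHom53 t U hd hn hΛ hclosed h0 hz hInj' μ ν
    hΛm O s B tt v hsh Y u b cw hcw ah dc V w a word hcert
  simp only [Nat.cast_ofNat, pow_one] at h
  exact h

end CRTTransposed

end Summit.Ventures.CertifiedManyBodySolver.Rows

end
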